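import Literature.NumberTheory.Rogawski1990.LocalNormFibreBlockDichotomyDock     -- ★ p841689 F0P3a-p08: `coe_dock_mul_dockFrame` (the dock reads `θ h` in the frame `y·W`)
import Literature.NumberTheory.Rogawski1990.LocalNormFibreBadFrameClasses        -- ★ p842136 F0P3a-p08: `twistGram_blocks_of_frame` (+ ★ p842076 the bad frame, `det_finSum`)
import HarnessLib

/-!
# The dock block is ISOTROPIC, so the bad block is ANISOTROPIC: `−det G₁ ∈ N(L_v^×)` and `−det G₁′ ∉ N(L_v^×)` (Rogawski 1990, §3.8 Prop. 3.8.1 (d): the two rank-2 determinant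
# classes at a non-split place; the dock carries `U(Φ₂)_v = U(1,1)`, the isotropic one)

Topic `NumberTheory/Rogawski1990`; namespace `Literature.NumberTheory.Rogawski1990`.  THEOREMS ONLY (no definition, no instance, no notation, no named fact, no `sorry`).
Cell `pub/hodgecm-mathlib` (D-0151), crux H413 = `stmt-HodgeConjecture-24833`, floor-2 line «N6nsGerm», stub `stub_N6nsS1`, binder `hcnt` (CNT) of ★ B-p08 p842024; LEAD F0P3a-plan
(g9) WORD T8-120 «(CNT-b)» ∕ T8-138; the ONE residual named in B-p04 (g34)'s 07:39Z line: clause (4) of `hcnt` (★ (CNT-b) FILE C `forall_charpoly_ne_finCharpolyTwo_of_not_compactSpace` ∕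
`anisotropic_of_neg_det_not_norm`) wants `−det G₁′ ∉ N`, while the bad-frame datum of ★ p842076 `exists_badFrame_dock` is `hnn : det G₁′ ∉ det G₁ · N`; this file supplies the
missing link `−det G₁ ∈ N` FROM THE DOCK.  Seat B-p04 (g34).  HONEST LABEL: HC_CM is proved only modulo the printed citations until rung 0 closes; unconditional local algebra.

THE MATHEMATICS.  The dock `θ : H_v ≃ₜ* Z_{G′_v}(ε)`, `θ z = y·ι(z)·y⁻¹`, reads EVERY `h ∈ H_v` in the frame `y·W` as the block matrix `h.1 ⊕ᶠ h.2` (★ `coe_dock_mul_dockFrame`); since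
`θ h ∈ U(H′)_v` and `ᵗσ(yW)·H′_v·(yW) = G₁ ⊕ᶠ G₂` (`hPW`), the MATRIX of every `h.1 ∈ U(Φ₂)_v` is `G₁`-unitary (★ `twistGram_blocks_of_frame`).  Taking the unipotent
`u(b) = (1 b; 0 1) ∈ U(Φ₂)_v` (`σ b = −b ≠ 0`, `b = δ ⊗ 1`): `ᵗσ(u) G₁ u = G₁` forces `(G₁)₀₀ = 0` — `e₀` is `G₁`-ISOTROPIC — hence `−det G₁ = (G₁)₀₁·σ(G₁)₀₁ = N((G₁)₀₁)` with
`(G₁)₀₁ ≠ 0` (`det G₁` is a unit).  With `hnn` (index two): `−det G₁′ ∈ N` would give `det G₁′ ∈ det G₁ · N`, so **`−det G₁′ ∉ N`** — the bad block is anisotropic (★ FILE C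
`anisotropic_of_neg_det_not_norm`).

References: [Rogawski1990] §3.8 Prop. 3.8.1 (d) p. 30, §4.8 p. 53, §8.1 Prop. 8.1.3 p. 110 · [Jacobowitz1962] §3 Thm. 3.1.
-/

set_option autoImplicit false

noncomputable section

open NumberField IsDedekindDomain Polynomial
open Matrix hiding mem_unitaryGroup_iff unitaryGroup
open scoped MatrixGroups

namespace Literature.NumberTheory.Rogawski1990

open Literature.NumberTheory.Automorphic
open Literature.NumberTheory.Automorphic.UnitaryGroup hiding hermForm hermForm_apply hermForm_mulVec
open Literature.AlgebraicGeometry.ShimuraVarieties (unitaryGroup mem_unitaryGroup_iff)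

section CM

variable (L : Type) [Field L] [NumberField L] [IsCMField L] (H' : Matrix (Fin 3) (Fin 3) L) (v : HeightOneSpectrum (𝓞 ↥(maximalRealSubfield L)))
  (w : PlacesOver L v) (hw : IsCMField.complexConj L • w.1 = w.1)

/-- `ᵗσ(u) G u = G` for `u = (1 b; 0 1)` with `σ b = −b` forces `b · G₀₀ = 0` (entry `(1,0)`). [cite: Rogawski1990, §3.8 Prop. 3.8.1 (d) p. 30] -/
private theorem mul_apply_zero_zero_eq_zero_of_unipotent {S : Type*} [CommRing S] (σ : S →+* S) {G : Matrix (Fin 2) (Fin 2) S} {b : S} (hb : σ b = -b)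
    (hu : twistGram σ G !![1, b; 0, 1] = G) : b * G 0 0 = 0 := by
  have h := congrFun (congrFun hu 1) 0
  rw [twistGram_def] at h
  simp [Matrix.mul_apply, Fin.sum_univ_two, Matrix.transpose_apply, Matrix.map_apply, hb] at h
  linear_combination h

/-- **EVERY `h.1 ∈ U(Φ₂)_v` IS `G₁`-UNITARY AS A MATRIX** when `θ` docks `H_v` onto `Z(ε)` and the dock frame `y·W` has Gram `G₁ ⊕ᶠ G₂`.
[cite: Rogawski1990, §4.8 p. 53; §8.1 Prop. 8.1.3 p. 110] -/
theorem twistGram_dockBlock_fst_eq {ε : (cmDatum L 3 H').Local v} {y : GL (Fin 3) (LocalRing L v)}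
    (θ : ((cmDatum L 2 (Matrix.of fun i j : Fin 2 => if i.val + j.val + 1 = 2 then (1 : L) else 0)).Local v × (cmDatum L 1 (Matrix.of fun i j : Fin 1 => if i.val + j.val + 1 = 1 then (1 : L) else 0)).Local v) ≃ₜ* ↥(Subgroup.centralizer ({ε} : Set ((cmDatum L 3 H').Local v))))
    (hθ : ∀ z : ((cmDatum L 2 (Matrix.of fun i j : Fin 2 => if i.val + j.val + 1 = 2 then (1 : L) else 0)).Local v × (cmDatum L 1 (Matrix.of fun i j : Fin 1 => if i.val + j.val + 1 = 1 then (1 : L) else 0)).Local v), (((θ z).1).val : GL (Fin 3) (LocalRing L v)) = y * ((endoEmbLocal L v z).val : GL (Fin 3) (LocalRing L v)) * y⁻¹)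
    {W : GL (Fin 3) (LocalRing L v)} (hW : W.val = !![(1 : (LocalRing L v)), 0, 0; 0, 0, 1; 0, 1, 0])
    {G₁ : Matrix (Fin 2) (Fin 2) (LocalRing L v)} {G₂ : Matrix (Fin 1) (Fin 1) (LocalRing L v)}
    (hPW : twistGram (conjLocal L (IsCMField.complexConj L) v) ((adelicForm L 3 H').map (adeleToLocal L v)) (y * W).val = finSum 2 1 G₁ G₂) (h : ((cmDatum L 2 (Matrix.of fun i j : Fin 2 => if i.val + j.val + 1 = 2 then (1 : L) else 0)).Local v × (cmDatum L 1 (Matrix.of fun i j : Fin 1 => if i.val + j.val + 1 = 1 then (1 : L) else 0)).Local v)) :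
    twistGram (conjLocal L (IsCMField.complexConj L) v) G₁ (h.1.val.val : Matrix (Fin 2) (Fin 2) (LocalRing L v)) = G₁ := by
  have hframe := coe_dock_mul_dockFrame L H' v θ hθ hW h
  have hU : (((θ h : ↥(Subgroup.centralizer ({ε} : Set ((cmDatum L 3 H').Local v)))) : (cmDatum L 3 H').Local v)).val ∈ unitaryGroup (conjLocal L (IsCMField.complexConj L) v) ((adelicForm L 3 H').map (adeleToLocal L v)) :=
    (mem_unitaryGroup_iff (σ := (conjLocal L (IsCMField.complexConj L) v)) (H := ((adelicForm L 3 H').map (adeleToLocal L v))) (g := _)).2 ((mem_unitaryGroupOfForm_iff (σ := (conjLocal L (IsCMField.complexConj L) v)) (J := ((adelicForm L 3 H').map (adeleToLocal L v))) (g := _)).1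
      (((θ h : ↥(Subgroup.centralizer ({ε} : Set ((cmDatum L 3 H').Local v)))) : (cmDatum L 3 H').Local v)).2)
  exact (twistGram_blocks_of_frame (conjLocal L (IsCMField.complexConj L) v) (N₁ := 2) (N₂ := 1) ((adelicForm L 3 H').map (adeleToLocal L v)) hPW hU hframe).1

include hw in
/-- **THE DOCK BLOCK IS ISOTROPIC: `−det G₁ ∈ N(L_v^×)`.**  The unipotent `u(δ ⊗ 1) ∈ U(Φ₂)_v` is `G₁`-unitary, so `(G₁)₀₀ = 0` and `−det G₁ = N((G₁)₀₁)`, `(G₁)₀₁` a unit.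
[cite: Rogawski1990, §3.8 Prop. 3.8.1 (d) p. 30; §4.8 p. 53] [cite: Jacobowitz1962, §3 Thm. 3.1] -/
theorem exists_neg_det_dockBlock_eq_norm (hH' : (H'.map (cmConjRingHom L))ᵀ = H') (hdet' : H'.det ≠ 0) {ε : (cmDatum L 3 H').Local v} {y : GL (Fin 3) (LocalRing L v)}
    (θ : ((cmDatum L 2 (Matrix.of fun i j : Fin 2 => if i.val + j.val + 1 = 2 then (1 : L) else 0)).Local v × (cmDatum L 1 (Matrix.of fun i j : Fin 1 => if i.val + j.val + 1 = 1 then (1 : L) else 0)).Local v) ≃ₜ* ↥(Subgroup.centralizer ({ε} : Set ((cmDatum L 3 H').Local v))))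
    (hθ : ∀ z : ((cmDatum L 2 (Matrix.of fun i j : Fin 2 => if i.val + j.val + 1 = 2 then (1 : L) else 0)).Local v × (cmDatum L 1 (Matrix.of fun i j : Fin 1 => if i.val + j.val + 1 = 1 then (1 : L) else 0)).Local v), (((θ z).1).val : GL (Fin 3) (LocalRing L v)) = y * ((endoEmbLocal L v z).val : GL (Fin 3) (LocalRing L v)) * y⁻¹)
    {W : GL (Fin 3) (LocalRing L v)} (hW : W.val = !![(1 : (LocalRing L v)), 0, 0; 0, 0, 1; 0, 1, 0])
    {G₁ : Matrix (Fin 2) (Fin 2) (LocalRing L v)} {G₂ : Matrix (Fin 1) (Fin 1) (LocalRing L v)}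
    (hPW : twistGram (conjLocal L (IsCMField.complexConj L) v) ((adelicForm L 3 H').map (adeleToLocal L v)) (y * W).val = finSum 2 1 G₁ G₂) :
    ∃ z : (LocalRing L v), IsUnit z ∧ -G₁.det = (conjLocal L (IsCMField.complexConj L) v) z * z := by
  classical
  have hc1 : IsCMField.complexConj L ≠ 1 := IsCMField.complexConj_ne_one L
  letI : Field (LocalRing L v) := (LocalRing.isField_of_smul_eq (IsCMField.complexConj L) hc1 w hw).toField
  have hσσ : ∀ x : (LocalRing L v), (conjLocal L (IsCMField.complexConj L) v) ((conjLocal L (IsCMField.complexConj L) v) x) = x := conjLocal_conjLocal (IsCMField.complexConj L) v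
    (GelbartRogawski1991.UnitaryDualPair.complexConj_imagUnit L) (GelbartRogawski1991.UnitaryDualPair.imagUnit_ne_zero L)
  -- `G₁` is hermitian with unit determinant (blocks of the hermitian unit-determinant `ᵗσ(yW) H′_v (yW)`)
  have hHv := map_conjLocal_transpose_localForm L 3 H' v hH'
  have hHvd := isUnit_det_localForm L 3 H' v hdet'
  have hGh : ((finSum 2 1 G₁ G₂).map (conjLocal L (IsCMField.complexConj L) v))ᵀ = finSum 2 1 G₁ G₂ := by rw [← hPW]; exact conjTranspose_twistGram (conjLocal L (IsCMField.complexConj L) v) _ hσσ hHv (y * W).val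
  have h10 : G₁ 1 0 = (conjLocal L (IsCMField.complexConj L) v) (G₁ 0 1) := by
    have h := congrFun (congrFun hGh 1) 0
    rw [Matrix.transpose_apply, Matrix.map_apply] at h
    have e1 : finSum 2 1 G₁ G₂ 1 0 = G₁ 1 0 := by simp [finSum, Matrix.fromBlocks, finSumFinEquiv, Fin.addCases]
    have e2 : finSum 2 1 G₁ G₂ 0 1 = G₁ 0 1 := by simp [finSum, Matrix.fromBlocks, finSumFinEquiv, Fin.addCases]
    rw [e1, e2] at h
    exact h.symm
  have hGd : IsUnit G₁.det := by
    have hd : IsUnit (twistGram (conjLocal L (IsCMField.complexConj L) v) ((adelicForm L 3 H').map (adeleToLocal L v)) (y * W).val).det := by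
      rw [det_twistGram]
      have hyu : IsUnit (y * W).val.det := by have hh := (y * W).isUnit; rwa [Matrix.isUnit_iff_isUnit_det] at hh
      exact ((hyu.map _).mul hHvd).mul hyu
    rw [hPW, det_finSum] at hd
    exact isUnit_of_mul_isUnit_left hd
  -- the unipotent `u(b)`, `b = δ ⊗ 1`, `σ b = −b ≠ 0`
  obtain ⟨δ, hcδ, hδ⟩ : ∃ δ : L, IsCMField.complexConj L δ = -δ ∧ δ ≠ 0 := by
    obtain ⟨ζ, hζ⟩ := not_forall.1 fun h0 => hc1 (AlgEquiv.ext h0)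
    refine ⟨ζ - IsCMField.complexConj L ζ, by rw [map_sub, IsCMField.complexConj_apply_apply, neg_sub], fun h0 => hζ ?_⟩
    rw [sub_eq_zero] at h0
    exact h0.symm
  set b : (LocalRing L v) := algebraMap L (LocalRing L v) δ with hbdef
  have hb : (conjLocal L (IsCMField.complexConj L) v) b = -b := by rw [hbdef, conjLocal_algebraMap, hcδ, map_neg]
  have hb0 : b ≠ 0 := fun h0 => hδ ((algebraMap L (LocalRing L v)).injective (by rw [map_zero]; exact h0))
  -- the local Gram matrix of `Φ₂` is `antidiag(1, 1)` and `u(b) ∈ U(Φ₂)_v`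
  have hJ : ((adelicForm L 2 (Matrix.of fun i j : Fin 2 => if i.val + j.val + 1 = 2 then (1 : L) else 0)).map (adeleToLocal L v)) = !![(0 : (LocalRing L v)), 1; 1, 0] := by
    rw [Liu2021.LemD1OfPlace.localGram_eq L v 2 (Matrix.of fun i j : Fin 2 => if i.val + j.val + 1 = 2 then (1 : L) else 0)]
    ext i j
    fin_cases i <;> fin_cases j <;> simp
  set U : GL (Fin 2) (LocalRing L v) := ⟨!![1, b; 0, 1], !![1, -b; 0, 1], by simp [Matrix.one_fin_two], by simp [Matrix.one_fin_two]⟩ with hUdef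
  have hUmem : U ∈ «local» L (IsCMField.complexConj L) 2 (Matrix.of fun i j : Fin 2 => if i.val + j.val + 1 = 2 then (1 : L) else 0) v := by
    show U ∈ unitaryGroupOfForm _ _
    rw [mem_unitaryGroupOfForm_iff, hJ]
    ext i j
    fin_cases i <;> fin_cases j <;> simp [hUdef, Matrix.mul_apply, Fin.sum_univ_two, hb]
  -- its matrix is `G₁`-unitary
  have hU1 := twistGram_dockBlock_fst_eq L H' v θ hθ hW hPW ((⟨U, hUmem⟩ : (cmDatum L 2 (Matrix.of fun i j : Fin 2 => if i.val + j.val + 1 = 2 then (1 : L) else 0)).Local v), (1 : (cmDatum L 1 (Matrix.of fun i j : Fin 1 => if i.val + j.val + 1 = 1 then (1 : L) else 0)).Local v))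
  have hU1' : twistGram (conjLocal L (IsCMField.complexConj L) v) G₁ !![1, b; 0, 1] = G₁ := hU1
  have h00 : G₁ 0 0 = 0 := (mul_eq_zero.1 (mul_apply_zero_zero_eq_zero_of_unipotent (conjLocal L (IsCMField.complexConj L) v) hb hU1')).resolve_left hb0
  refine ⟨G₁ 0 1, Ne.isUnit fun h01 => hGd.ne_zero ?_, ?_⟩
  · rw [Matrix.det_fin_two, h00, h01, zero_mul, zero_mul, sub_zero]
  · rw [Matrix.det_fin_two, h00, h10, zero_mul, zero_sub, neg_neg, mul_comm]

include hw in
/-- **THE BAD BLOCK IS ANISOTROPIC: `−det G₁′ ∉ N(L_v^×)`** — from the dock (`−det G₁ ∈ N`) and the bad-frame datum `hnn : det G₁′ ∉ det G₁ · N` of ★ `exists_badFrame_dock` (index two).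
This is the hypothesis `hnn′` of ★ (CNT-b) FILE C `anisotropic_of_neg_det_not_norm` ∕ clause (4) `forall_charpoly_ne_finCharpolyTwo_of_not_compactSpace`.
[cite: Rogawski1990, §3.8 Prop. 3.8.1 (d) p. 30; §8.1 Prop. 8.1.3 p. 110] -/
theorem not_exists_neg_det_badBlock_eq_norm (hH' : (H'.map (cmConjRingHom L))ᵀ = H') (hdet' : H'.det ≠ 0) {ε : (cmDatum L 3 H').Local v} {y : GL (Fin 3) (LocalRing L v)}
    (θ : ((cmDatum L 2 (Matrix.of fun i j : Fin 2 => if i.val + j.val + 1 = 2 then (1 : L) else 0)).Local v × (cmDatum L 1 (Matrix.of fun i j : Fin 1 => if i.val + j.val + 1 = 1 then (1 : L) else 0)).Local v) ≃ₜ* ↥(Subgroup.centralizer ({ε} : Set ((cmDatum L 3 H').Local v))))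
    (hθ : ∀ z : ((cmDatum L 2 (Matrix.of fun i j : Fin 2 => if i.val + j.val + 1 = 2 then (1 : L) else 0)).Local v × (cmDatum L 1 (Matrix.of fun i j : Fin 1 => if i.val + j.val + 1 = 1 then (1 : L) else 0)).Local v), (((θ z).1).val : GL (Fin 3) (LocalRing L v)) = y * ((endoEmbLocal L v z).val : GL (Fin 3) (LocalRing L v)) * y⁻¹)
    {W : GL (Fin 3) (LocalRing L v)} (hW : W.val = !![(1 : (LocalRing L v)), 0, 0; 0, 0, 1; 0, 1, 0])
    {G₁ G₁' : Matrix (Fin 2) (Fin 2) (LocalRing L v)} {G₂ : Matrix (Fin 1) (Fin 1) (LocalRing L v)}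
    (hPW : twistGram (conjLocal L (IsCMField.complexConj L) v) ((adelicForm L 3 H').map (adeleToLocal L v)) (y * W).val = finSum 2 1 G₁ G₂)
    (hnn : ¬ ∃ z : (LocalRing L v), IsUnit z ∧ G₁'.det = G₁.det * ((conjLocal L (IsCMField.complexConj L) v) z * z)) :
    ¬ ∃ z : (LocalRing L v), IsUnit z ∧ -G₁'.det = (conjLocal L (IsCMField.complexConj L) v) z * z := by
  rintro ⟨z', hz'u, hz'⟩
  obtain ⟨z, hzu, hz⟩ := exists_neg_det_dockBlock_eq_norm L H' v w hw hH' hdet' θ hθ hW hPW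
  -- `det G₁′ = det G₁ · N(z′ z⁻¹)`
  refine hnn ⟨z' * ↑(hzu.unit⁻¹), hz'u.mul (hzu.unit⁻¹).isUnit, ?_⟩
  have h1 : G₁'.det = -((conjLocal L (IsCMField.complexConj L) v) z' * z') := by rw [← hz', neg_neg]
  have h2 : G₁.det = -((conjLocal L (IsCMField.complexConj L) v) z * z) := by rw [← hz, neg_neg]
  have h3 : z * ↑(hzu.unit⁻¹) = 1 := hzu.mul_val_inv
  have h4 : (conjLocal L (IsCMField.complexConj L) v) z * (conjLocal L (IsCMField.complexConj L) v) ↑(hzu.unit⁻¹) = 1 := by rw [← map_mul, h3, map_one]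
  rw [h1, h2, map_mul]
  have e : -((conjLocal L (IsCMField.complexConj L) v) z * z) * ((conjLocal L (IsCMField.complexConj L) v) z' * (conjLocal L (IsCMField.complexConj L) v) ↑(hzu.unit⁻¹) * (z' * ↑(hzu.unit⁻¹))) =
      -((conjLocal L (IsCMField.complexConj L) v) z' * z') * (((conjLocal L (IsCMField.complexConj L) v) z * (conjLocal L (IsCMField.complexConj L) v) ↑(hzu.unit⁻¹)) * (z * ↑(hzu.unit⁻¹))) := by ring
  rw [e, h4, h3, mul_one, mul_one]

end CM

end Literature.NumberTheory.Rogawski1990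

end
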